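import Summits.ResolutionOfSingularities.ResolutionOfSingularities.Theorems.DeltaCutStellarHypTame

/-!
# StellarCut T17a — «HypFree»: the UNIT-FREE hypersurface shape `ncHypShapeF`, the SAFE-FACE predicate, and the generator half
# of the round lemma (lens-6 «barrier-complement carving», g34; 0-weight tool of the wild coprime law `DeltaCutStellarWild`)

`DeltaCutStellarHypShape.ncHypShape n` (T10) carries the clause `n ∈ 𝒪_{X,x}^×` at every point — the TAME hypothesis `p ∤ n`.
THIS FILE drops it: `ncHypShapeF n` = marking `n`; the `H`-entries of `E` labelled `0`; the principal presentation
`𝓘_x = (hⁿ + u·m)` along `V(H)`; `supp M ⊆ V(H)` — and re-derives, WITHOUT the unit,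

* §API / §Support — the pointwise support criterion, FACE and TERMINAL lemmas (proofs of T10 verbatim; they never used the unit);
* §Round — `ncHypShapeF.exists_generator_transform`, `ncHypShapeF.transform_of_support_subset`: the GENERATOR HALF of the round
  lemma (T11 verbatim: divisor identities + the colon formula; the unit was only carried along);
* `SafeFace n X E T := n < weightOf E T ∨ (∀ x, n ∈ 𝒪_x^×) ∨ (∀ K ∈ T, ∀ y ∈ V(K), expOf E K = 0 ∨ expOf E K ∈ 𝒪_y^×)` — a HEAVY
  face, or a TAME marking, or WILD-COPRIME exponents on the face; its round lemma is `DeltaCutStellarHypSafe` (T17b).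

0 sorry; axioms standard. [new] [folklore] [cite: Kollar2007, (3.111) Step 3] [cite: BierstoneGrigorievMilmanWlodarczyk2011, §3.2 and §4 Step 2b]
[cite: AtiyahMacdonald1969, Cor. 3.15]
-/
noncomputable section

open CategoryTheory CategoryTheory.Limits AlgebraicGeometry TopologicalSpace IsLocalRing
open Literature.AlgebraicGeometry.Resolution

namespace Summit.ResolutionOfSingularities.ResolutionOfSingularities.Theorems.DeltaCutClasses

open Summit.ResolutionOfSingularities.ResolutionOfSingularities.Theorems
open WeakOrderReduction ForcedTowerClasses

/-! ### §Shape — the unit-free hypersurface shape -/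

/-- **THE UNIT-FREE HYPERSURFACE SHAPE `ncHypShapeF n`** (a `Shape`): marking `n`; the `H`-entries of `E` have label `0` (or
`V(H) = ∅`); at every `x ∈ V(H)` the stalk ideal is `(hⁿ + u·m)`, `u` a unit, `(h) = H_x`, `(m) = 𝓜(E)_x`; `supp(M) ⊆ V(H)`.
(`ncHypShape n` of T10 minus the stalk-unit clause `n ∈ 𝒪^×`.) -/
def ncHypShapeF (n : ℕ) : Shape := fun X E H M =>
  M.mult = n ∧ (∀ q ∈ E, q.1 = H → q.2 = 0 ∨ (H.support : Set X) = ∅) ∧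
    (∀ x : X, x ∈ H.support → ∃ h m u : X.presheaf.stalk x, IsUnit u ∧ stalkIdeal H x = Ideal.span {h} ∧
      stalkIdeal (monomialIdeal E) x = Ideal.span {m} ∧ stalkIdeal M.ideal x = Ideal.span {h ^ n + u * m}) ∧
    M.support ⊆ (H.support : Set X)

/-- **A SAFE FACE**: a face `T` (through `H`) of the labelled boundary `E` at marking `n` is SAFE when it is HEAVY (`weightOf E T > n`),
or `n` is a unit in every stalk (TAME), or the exponent of every member `K` of `T` is `0` or a unit in the stalks along `V(K)`
(WILD-COPRIME). -/
def SafeFace (n : ℕ) (X : Scheme.{0}) (E : List (X.IdealSheafData × ℕ)) (T : Finset X.IdealSheafData) : Prop :=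
  n < weightOf E T ∨ (∀ x : X, IsUnit ((n : ℕ) : X.presheaf.stalk x)) ∨
    ∀ K ∈ T, ∀ y : X, y ∈ K.support → expOf E K = 0 ∨ IsUnit ((expOf E K : ℕ) : X.presheaf.stalk y)

section API

variable {X : Scheme.{0}} {E : List (X.IdealSheafData × ℕ)} {H : X.IdealSheafData} {n : ℕ} {M : MarkedIdeal X}

namespace ncHypShapeF

/-- the marking is `n` -/
theorem mult_eq (hP : ncHypShapeF n X E H M) : M.mult = n := hP.1

/-- the `H`-entries of `E` carry the label `0` (or `V(H) = ∅`) -/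
theorem label_eq_zero (hP : ncHypShapeF n X E H M) {q : X.IdealSheafData × ℕ} (hq : q ∈ E) (hqH : q.1 = H) :
    q.2 = 0 ∨ (H.support : Set X) = ∅ := hP.2.1 q hq hqH

/-- the hypersurface presentation at a point of `V(H)` -/
theorem exists_generator (hP : ncHypShapeF n X E H M) {x : X} (hx : x ∈ H.support) :
    ∃ h m u : X.presheaf.stalk x, IsUnit u ∧ stalkIdeal H x = Ideal.span {h} ∧
      stalkIdeal (monomialIdeal E) x = Ideal.span {m} ∧ stalkIdeal M.ideal x = Ideal.span {h ^ n + u * m} :=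
  hP.2.2.1 x hx

/-- `supp(M) ⊆ V(H)` -/
theorem support_subset (hP : ncHypShapeF n X E H M) : M.support ⊆ (H.support : Set X) := hP.2.2.2

/-- the tame shape is a unit-free shape -/
theorem of_ncHypShape (hP : ncHypShape n X E H M) : ncHypShapeF n X E H M :=
  ⟨hP.mult_eq, fun _ hq hqH => hP.label_eq_zero hq hqH, fun _ hx => hP.exists_generator hx, hP.support_subset⟩

/-- a unit-free shape in whose stalks `n` is a unit is a tame shape -/
theorem ncHypShape_of_isUnit (hP : ncHypShapeF n X E H M) (hu : ∀ x : X, IsUnit ((n : ℕ) : X.presheaf.stalk x)) :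
    ncHypShape n X E H M :=
  ⟨hP.mult_eq, hu, hP.2.1, hP.2.2.1, hP.support_subset⟩

/-- **AT A POINT OF `V(H)`: `x ∈ supp(M) ⟺ 𝓜(E)_x ⊆ 𝔪_xⁿ`** (`hⁿ ∈ 𝔪ⁿ`, `u` a unit; T10 verbatim). [folklore] -/
theorem mem_support_iff (hP : ncHypShapeF n X E H M) {x : X} (hx : x ∈ H.support) :
    x ∈ M.support ↔ stalkIdeal (monomialIdeal E) x ≤ maximalIdeal (X.presheaf.stalk x) ^ n := by
  obtain ⟨h, m, u, hu, hHx, hMx, hIx⟩ := hP.exists_generator hx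
  rw [MarkedIdeal.mem_support_iff, hP.mult_eq, hIx, hMx, Ideal.span_singleton_le_iff_mem,
    Ideal.span_singleton_le_iff_mem]
  have hh := mem_maximalIdeal_of_stalkIdeal_eq_span hx hHx
  exact ⟨mem_pow_of_pow_add_unit_mul_mem hu hh, pow_add_mul_mem_pow u hh⟩

/-- **AT A POINT OF `V(H)`: `x ∈ supp(M) ⟺ n ≤ weightAt E x`** (boundary s.n.c.). [cite: BierstoneGrigorievMilmanWlodarczyk2011, §4 Step 2b] -/
theorem mem_support_iff_weightAt (hE : HasSNC (boundaryOf E)) (hP : ncHypShapeF n X E H M) {x : X}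
    (hx : x ∈ H.support) : x ∈ M.support ↔ n ≤ weightAt E x := by
  rw [hP.mem_support_iff hx, ← le_idealOrder_monomialIdeal_iff hE n x, le_idealOrder_iff]

end ncHypShapeF

/-- **FACE LEMMA** for the unit-free shape: a face through `H` of weight `≥ n` lies in the support (T10 verbatim).
[cite: Kollar2007, (3.111) Step 3] -/
theorem support_finsetSup_subset_support_ncHypShapeF (hEs : HasSNC (H :: boundaryOf E)) {T : Finset X.IdealSheafData}
    (hHT : H ∈ T) (hmT : n ≤ weightOf E T) (hP : ncHypShapeF n X E H M) :
    ((T.sup id).support : Set X) ⊆ M.support := by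
  intro x hx
  have hxH : x ∈ H.support := (mem_support_finsetSup_iff T x).mp hx H hHT
  rw [hP.mem_support_iff hxH]
  have hE' : HasSNC (boundaryOf ((H, 0) :: E)) := hEs
  have hn' : n ≤ weightOf ((H, 0) :: E) T := by rwa [weightOf_cons_zero]
  have hmem := support_finsetSup_subset_support_monomialMarked hE' hn' hx
  rwa [MarkedIdeal.mem_support_iff, monomialMarked_ideal, monomialMarked_mult, monomialIdeal_cons_zero] at hmem

/-- **TERMINAL LEMMA** for the unit-free shape: if every point of `V(H)` has boundary weight `< n`, the support is empty
(T10 verbatim). [cite: Kollar2007, (3.111) Step 3] -/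
theorem support_ncHypShapeF_eq_empty (hE : HasSNC (boundaryOf E)) (hP : ncHypShapeF n X E H M)
    (h : ∀ x ∈ H.support, weightAt E x < n) : M.support = ∅ := by
  ext x
  simp only [Set.mem_empty_iff_false, iff_false]
  intro hx
  have hxH : x ∈ H.support := hP.support_subset hx
  exact absurd (h x hxH) (not_lt.mpr ((hP.mem_support_iff_weightAt hE hxH).mp hx))

end API

/-! ### §Round — generator half (T11 verbatim, unit-free) -/

section Round

variable {X X' : Scheme.{0}} [IsLocallyNoetherian X] {π : X' ⟶ X} {H : X.IdealSheafData}
  {E : List (X.IdealSheafData × ℕ)} {T : Finset X.IdealSheafData} {n : ℕ} {M : MarkedIdeal X}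

/-- **GENERATOR HALF of the round lemma, unit-free**: at every `x' ∈ V(H')` the stalk of the transformed ideal is
`(h'ⁿ + u'·m')`, `u'` a unit, `(h') = H'_{x'}`, `(m') = 𝓜(transformExp E π T n)_{x'}` (T11's proof verbatim).
[cite: Kollar2007, (3.111) Step 3] [cite: BierstoneGrigorievMilmanWlodarczyk2011, §3.2 Lemma 3.2.1] [cite: AtiyahMacdonald1969, Cor. 3.15] -/
theorem ncHypShapeF.exists_generator_transform (hEs : HasSNC (H :: boundaryOf E)) (hT : ∀ K ∈ T, K ∈ H :: boundaryOf E)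
    (hHT : H ∈ T) (hπ : IsBlowup π (T.sup id)) (hmT : n ≤ weightOf E T) (hP : ncHypShapeF n X E H M) {x' : X'}
    (hx' : x' ∈ (strictTransformIdeal π (T.sup id) H).support) :
    ∃ h' m' u' : X'.presheaf.stalk x', IsUnit u' ∧
      stalkIdeal (strictTransformIdeal π (T.sup id) H) x' = Ideal.span {h'} ∧
      stalkIdeal (monomialIdeal (transformExp E π T n)) x' = Ideal.span {m'} ∧
      stalkIdeal (M.transform π (T.sup id)).ideal x' = Ideal.span {h' ^ n + u' * m'} := by
  classical
  haveI : IsProper π := hπ.isProper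
  haveI : IsLocallyNoetherian X' := LocallyOfFiniteType.isLocallyNoetherian π
  have hEs' : HasSNC (strictTransformIdeal π (T.sup id) H :: boundaryOf (transformExp E π T n)) :=
    hasSNC_ncShape_transform hEs hT hπ n
  haveI : IsRegularLocalRing (X'.presheaf.stalk x') := (hEs' x').1
  haveI : IsDomain (X'.presheaf.stalk x') := isDomain_of_isRegularLocalRing _
  have hy : π x' ∈ H.support := mem_support_of_mem_support_strictTransformIdeal hx'
  obtain ⟨h, m, u, hu, hHx, hMx, hIx⟩ := hP.exists_generator hy
  obtain ⟨h₀, -, hH₀⟩ := exists_ne_zero_stalkIdeal_eq_span hEs' List.mem_cons_self x'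
  obtain ⟨ε, hε0, hε⟩ := exists_ne_zero_stalkIdeal_eq_span hEs' (comap_mem_frame_transform n) x'
  obtain ⟨m', hm'⟩ := exists_stalkIdeal_monomialIdeal_eq_span (hasSNC_boundaryOf_of_cons hEs') x'
  set φ := (π.stalkMap x').hom with hφ
  -- (a) `π^*(h) = (h₀')(ε)`
  have ha : Ideal.span {h₀ * ε} = Ideal.span {φ h} := by
    have := map_stalkIdeal_eq_mul_of_mem hEs hT hπ hHT x'
    rw [hHx, Ideal.map_span, Set.image_singleton, hH₀, hε, Ideal.span_singleton_mul_span_singleton] at this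
    exact this.symm
  obtain ⟨v₁, hv₁⟩ := Ideal.span_singleton_eq_span_singleton.mp ha
  -- (b) `π^*(m) = (ε)ⁿ (m')`
  have hb : Ideal.span {ε ^ n * m'} = Ideal.span {φ m} := by
    have hE₀ : HasSNC (boundaryOf ((H, 0) :: E)) := hEs
    have hT₀ : ∀ K ∈ T, K ∈ boundaryOf ((H, 0) :: E) := hT
    have hst := congrArg (fun J => stalkIdeal J x') (comap_monomialIdeal hE₀ hT₀ hπ)
    simp only [List.map_cons] at hst
    rw [stalkIdeal_comap_eq_map_stalkMap, monomialIdeal_cons_zero, hMx, Ideal.map_span, Set.image_singleton,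
      stalkIdeal_mul, stalkIdeal_pow, hε, weightOf_cons_zero, monomialIdeal_cons_zero, Ideal.span_singleton_pow] at hst
    have hm₂ : Ideal.span {m'} = stalkIdeal (monomialIdeal
        (E.map fun p => (strictTransformIdeal π (T.sup id) p.1, p.2))) x' * Ideal.span {ε ^ (weightOf E T - n)} := by
      rw [← hm', transformExp, monomialIdeal_append, monomialIdeal_singleton, stalkIdeal_mul, stalkIdeal_pow, hε,
        Ideal.span_singleton_pow]
    rw [← hφ] at hst
    rw [hst, mul_comm (ε ^ n) m', ← Ideal.span_singleton_mul_span_singleton, hm₂, mul_assoc,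
      Ideal.span_singleton_mul_span_singleton, ← pow_add, Nat.sub_add_cancel hmT, mul_comm]
  obtain ⟨v₂, hv₂⟩ := Ideal.span_singleton_eq_span_singleton.mp hb
  -- (c) the controlled transform
  refine ⟨h₀ * ↑v₁, m', φ u * ↑v₂, (hu.map φ).mul v₂.isUnit, ?_, hm', ?_⟩
  · rw [hH₀, Ideal.span_singleton_mul_right_unit v₁.isUnit]
  · rw [MarkedIdeal.transform_ideal, hP.mult_eq, hπ.stalkIdeal_controlledTransform, stalkIdeal_comap_eq_map_stalkMap,
      hIx, Ideal.map_span, Set.image_singleton, hε, ← hφ,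
      map_pow_add_mul_eq φ u (h' := h₀ * ↑v₁) (ε := ε) (m' := m') (v := ↑v₂) (by rw [← hv₁]; ring) (by rw [← hv₂]),
      colon_span_pow_mul hε0]

/-- **THE UNIT-FREE SHAPE SURVIVES A FACE ROUND, given the guard `supp M' ⊆ V(H')`** (T11 verbatim minus the unit clause).
[cite: Kollar2007, (3.111) Step 3] -/
theorem ncHypShapeF.transform_of_support_subset (hEs : HasSNC (H :: boundaryOf E)) (hT : ∀ K ∈ T, K ∈ H :: boundaryOf E)
    (hHT : H ∈ T) (hπ : IsBlowup π (T.sup id)) (hmT : n ≤ weightOf E T) (hP : ncHypShapeF n X E H M)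
    (hSupp : (M.transform π (T.sup id)).support ⊆ ((strictTransformIdeal π (T.sup id) H).support : Set X')) :
    ncHypShapeF n X' (transformExp E π T n) (strictTransformIdeal π (T.sup id) H) (M.transform π (T.sup id)) := by
  haveI : IsProper π := hπ.isProper
  haveI : IsLocallyNoetherian X' := LocallyOfFiniteType.isLocallyNoetherian π
  refine ⟨by rw [MarkedIdeal.transform_mult, hP.mult_eq], ?_,
    fun x' hx' => hP.exists_generator_transform hEs hT hHT hπ hmT hx', hSupp⟩
  -- the label clause
  intro q hq hqH
  by_cases hV : ((strictTransformIdeal π (T.sup id) H).support : Set X') = ∅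
  · exact Or.inr hV
  · refine Or.inl ?_
    obtain ⟨x', hx'⟩ := Set.nonempty_iff_ne_empty.mpr hV
    have hx'' : x' ∈ (strictTransformIdeal π (T.sup id) H).support := hx'
    rw [transformExp, List.mem_append, List.mem_map, List.mem_singleton] at hq
    rcases hq with ⟨p, hp, rfl⟩ | rfl
    · have hpE : p.1 ∈ H :: boundaryOf E := List.mem_cons_of_mem _ (fst_mem_boundaryOf hp)
      have heq : H = p.1 := eq_of_strictTransformIdeal_eq hEs hT hπ List.mem_cons_self hpE hx'' hqH.symm
      have hy : π x' ∈ H.support := mem_support_of_mem_support_strictTransformIdeal hx''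
      exact (hP.label_eq_zero hp heq.symm).resolve_right (Set.nonempty_iff_ne_empty.mp ⟨π x', hy⟩)
    · exfalso
      have hqH' : (T.sup id).comap π = strictTransformIdeal π (T.sup id) H := hqH
      have hxF : x' ∈ ((T.sup id).comap π).support := by rw [hqH']; exact hx''
      exact strictTransformIdeal_ne_comap hEs hT hπ List.mem_cons_self hxF hqH'.symm

end Round

end Summit.ResolutionOfSingularities.ResolutionOfSingularities.Theorems.DeltaCutClasses
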